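import Summits.QuantumAdvantage.QuantumAdvantage.Theorems.SosSandwichTransferPBQueryCrux
import Summits.QuantumAdvantage.QuantumAdvantage.Theorems.SosSandwichQueryAAQBand
import Summits.QuantumAdvantage.QuantumAdvantage.Theorems.SosSandwichPseudoBoundedAAHighLevels
import HarnessLib

/-!
# Route `SosSandwich`, crux `PseudoBoundedAA` (stmt-QuantumAdvantage-15237): the summit assembly from the
# DEEP-BAND form of the analytic crux

Composition only (planner-facing).  The landed chain `QueryCrux.quantumAdvantage_of_aaQuery`
(`AA_Q → RandomOracleHeurSeparation → PromiseLanguageLift → QuantumAdvantage`, via the circuit→query bridge and the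
closed `TransferPB` machine chain) composed with this generation's equivalences
`LevelTwoRung.aaQuery_of_band` / `aaQuery_of_middleBand` (the analytic crux is its deep-band case) and
`LevelKRung.pseudoBoundedAA_of_highLevels` (the route decl `PseudoBoundedAA` is its high-level case):

* `quantumAdvantage_of_bandAAQ K₀` — **deep-band `AA_Q` (any fixed depth `K₀`) → X_ROG → PL → QuantumAdvantage**;
  `transfer_of_bandAAQ K₀` — deep-band `AA_Q` → (`PromiseBQP ⊆ PromiseBPP'` → a.e. `BQP^A ⊆ AvgP^A`);
* `quantumAdvantage_of_middleBandAAQ` — the case `K₀ = 2`;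
* `closes_of_highLevelsPBAA K₀` — the route's own `closes` with its first hypothesis `PseudoBoundedAA` narrowed to
  high-level PB-AA (depth `K₀`).

These are the deciding-theorem shapes a re-lined crux would use (stubs: the band statement — research — and nothing
else new).  Honest label: composition of landed theorems; no stub, crux or summit is proved.
Sources: Aaronson–Ambainis 2014 Thm. 7(iii); the route file `Theses/SosSandwich.lean` (`closes`).
-/

-- D-0017: single-conjunct summit ⇒ the duplicate `QuantumAdvantage.QuantumAdvantage` is mandated.
set_option linter.dupNamespace false

noncomputable section

namespace Summit.QuantumAdvantage.QuantumAdvantage.Theorems.SosSandwich.LevelTwoRung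

open Finset MeasureTheory
open Literature.Computability.QuantumComplexity
open Literature.Computability.Complexity.LowDegree (cubeFourierCoeff)
open Literature.Computability.Cryptography (QQueryAlg BQPRel)
open Summit.QuantumAdvantage.QuantumAdvantage.Theses.SosSandwich

/-- **Deep-band `AA_Q` → X_ROG → PL → QuantumAdvantage** (any fixed depth `K₀`): the summit assembly of route
SosSandwich with its analytic crux narrowed to quantum algorithms with `T ≥ 3` queries carrying at least a third of
the variance of their acceptance polynomial on the Walsh levels `K₀+1 … 2T-2`.
[cite: AaronsonAmbainis2014, Thm. 7 (iii)] -/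
theorem quantumAdvantage_of_bandAAQ (K₀ : ℕ)
    (hBand : ∃ (c : ℕ) (C : ℝ), 0 < C ∧ ∀ (N : ℕ) (Q : QQueryAlg N) (p : MvPolynomial (Fin N) ℝ) (ε : ℝ),
      3 ≤ Q.queries → (∀ x, evalBool p x = Q.acceptProb x) → 0 < ε → ε ≤ boolVariance p →
      boolVariance p ≤ 3 * ∑ k ∈ Finset.Icc (K₀ + 1) (2 * Q.queries - 2),
        ∑ S ∈ univ.filter (fun S : Finset (Fin N) => S.card = k), cubeFourierCoeff (evalBool p) S ^ 2 →
        ∃ i : Fin N, C * (ε / Q.queries) ^ c ≤ influence i p)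
    (hX : RandomOracleHeurSeparation) (hPL : PromiseLanguageLift) : _root_.QuantumAdvantage :=
  QueryCrux.quantumAdvantage_of_aaQuery (aaQuery_of_band K₀ hBand) hX hPL

/-- **Deep-band `AA_Q` gives the random-oracle transfer**: `PromiseBQP ⊆ PromiseBPP' → ∀ᵐ A, BQP^A ⊆ AvgP^A`.
[cite: AaronsonAmbainis2014, Thm. 7 (iii)] -/
theorem transfer_of_bandAAQ (K₀ : ℕ)
    (hBand : ∃ (c : ℕ) (C : ℝ), 0 < C ∧ ∀ (N : ℕ) (Q : QQueryAlg N) (p : MvPolynomial (Fin N) ℝ) (ε : ℝ),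
      3 ≤ Q.queries → (∀ x, evalBool p x = Q.acceptProb x) → 0 < ε → ε ≤ boolVariance p →
      boolVariance p ≤ 3 * ∑ k ∈ Finset.Icc (K₀ + 1) (2 * Q.queries - 2),
        ∑ S ∈ univ.filter (fun S : Finset (Fin N) => S.card = k), cubeFourierCoeff (evalBool p) S ^ 2 →
        ∃ i : Fin N, C * (ε / Q.queries) ^ c ≤ influence i p)
    (hPr : Literature.Computability.Cryptography.PromiseBQP ⊆ Literature.Computability.Complexity.PromiseBPP') :
    ∀ᵐ A ∂randomOracle,
      BQPRel (A : Language Bool) ⊆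
        Literature.Computability.Complexity.AvgPRel (Literature.Computability.Complexity.Oracle.ofLanguage (A : Language Bool)) :=
  QueryCrux.transfer_of_aaQuery (aaQuery_of_band K₀ hBand) hPr

/-- **Middle-band `AA_Q` → X_ROG → PL → QuantumAdvantage** (the case `K₀ = 2`, half of the variance on `3 … 2T-2`).
[cite: AaronsonAmbainis2014, Thm. 7 (iii)] -/
theorem quantumAdvantage_of_middleBandAAQ
    (hMB : ∃ (c : ℕ) (C : ℝ), 0 < C ∧ ∀ (N : ℕ) (Q : QQueryAlg N) (p : MvPolynomial (Fin N) ℝ) (ε : ℝ),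
      3 ≤ Q.queries → (∀ x, evalBool p x = Q.acceptProb x) → 0 < ε → ε ≤ boolVariance p →
      boolVariance p ≤ 2 * ∑ k ∈ Finset.Icc 3 (2 * Q.queries - 2),
        ∑ S ∈ univ.filter (fun S : Finset (Fin N) => S.card = k), cubeFourierCoeff (evalBool p) S ^ 2 →
        ∃ i : Fin N, C * (ε / Q.queries) ^ c ≤ influence i p)
    (hX : RandomOracleHeurSeparation) (hPL : PromiseLanguageLift) : _root_.QuantumAdvantage :=
  QueryCrux.quantumAdvantage_of_aaQuery (aaQuery_of_middleBand hMB) hX hPL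

/-- **The route's `closes` with `PseudoBoundedAA` narrowed to high-level PB-AA** (any fixed depth `K₀`).
[cite: AaronsonAmbainis2014, Thm. 7 (iii)] -/
theorem closes_of_highLevelsPBAA (K₀ : ℕ)
    (hHigh : ∃ (c : ℕ) (C : ℝ), 0 < C ∧ ∀ (N T : ℕ) (p : MvPolynomial (Fin N) ℝ) (ε : ℝ),
      1 ≤ T → PseudoBounded T p → 0 < ε → ε ≤ boolVariance p →
      boolVariance p ≤ 2 * ∑ k ∈ Finset.Icc (K₀ + 1) (2 * T),
        ∑ S ∈ univ.filter (fun S : Finset (Fin N) => S.card = k), cubeFourierCoeff (evalBool p) S ^ 2 →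
        ∃ i : Fin N, C * (ε / T) ^ c ≤ influence i p)
    (hT : TransferPB) (hX : RandomOracleHeurSeparation) (hPL : PromiseLanguageLift) : _root_.QuantumAdvantage :=
  closes (LevelKRung.pseudoBoundedAA_of_highLevels K₀ hHigh) hT hX hPL

end Summit.QuantumAdvantage.QuantumAdvantage.Theorems.SosSandwich.LevelTwoRung
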